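import Summits.QuantumFields.QCD.Theorems.SpectralDefectExtinctionWegnerEstimateStubPortContinuous

/-!
# Crux `WegnerEstimate` (item stmt-QuantumFields-8966), line `Sketch` gen 2c: the zero set of the port min-functional

Semantics of the bet `stub_portSmallBall`: for `R ≥ 1` the infimum defining `badPort R w` is ATTAINED (compact feasible
set, jointly continuous objective — `portContinuous_objective`, landed with `stub_portContinuous`), hence
`badPort R w = 0` iff the link datum `w` admits a unit port field with ALL cube currents zero, zero interior residual and
zero port-projected face residual for some `m₀ ∈ [−1, 0]`, `|λ| ≤ 1` — a non-zero port-admissible currentless field.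
So the bad variety `{badPort R = 0}` whose saturated tubes the bet prices is exactly the set of cell configurations
admitting such a field (Lines/Sketch.md §gen 2c).  Written by the line lead (prover-line-stmt-QuantumFields-8966-c2-0).
-/

noncomputable section

namespace Summit.QuantumFields.QCD.Cruxes.WegnerEstimate.ResolventCell

open scoped BigOperators
open Literature.MathematicalPhysics.QuantumLattice Literature.MathematicalPhysics.QuantumFieldTheory
  Literature.Probability.LatticeModels

/-- The centre of the cube lies in the port domain once `R ≥ 1` (it has no extreme coordinate). -/
theorem zero_mem_portDomain {R : ℕ} (hR : 1 ≤ R) : (0 : Fin 4 → ℤ) ∈ portDomain R := by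
  simp only [portDomain, Finset.mem_filter, extremeCount]
  refine ⟨zero_mem_box 4 R, ?_⟩
  have : (Finset.univ.filter fun μ : Fin 4 => |(0 : Fin 4 → ℤ) μ| = (R : ℤ)) = ∅ := by
    refine Finset.filter_eq_empty_iff.mpr fun μ _ => ?_
    simp only [Pi.zero_apply, abs_zero]
    omega
  rw [this, Finset.card_empty]
  omega

/-- For `R ≥ 1` there is a unit port field (the indicator of one index). -/
theorem exists_portNormSq_eq_one {R : ℕ} (hR : 1 ≤ R) : ∃ φ : PortField R, portNormSq R φ = 1 := by
  classical
  let p₀ : ↥(portDomain R) × Fin 3 × Fin 4 := (⟨0, zero_mem_portDomain hR⟩, 0, 0)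
  refine ⟨fun p => if p = p₀ then 1 else 0, ?_⟩
  simp only [portNormSq]
  rw [Finset.sum_eq_single p₀]
  · simp
  · intro p _ hp
    simp [hp]
  · intro h
    exact absurd (Finset.mem_univ p₀) h

/-- The feasible set of the min-functional, as the image of a compact set under the (jointly continuous) objective. -/
theorem badPort_set_eq_image (R : ℕ) (w : LinkData) :
    {r : ℝ | ∃ (m₀ lam : ℝ) (φ : PortField R), -1 ≤ m₀ ∧ m₀ ≤ 0 ∧ |lam| ≤ 1 ∧ portNormSq R φ = 1 ∧
      r = portCurrentSum R w φ + portInteriorResSq R m₀ lam w φ + portFaceResSq R m₀ lam w φ} =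
    (fun k : ℝ × ℝ × PortField R =>
        portCurrentSum R w k.2.2 + portInteriorResSq R k.1 k.2.1 w k.2.2 + portFaceResSq R k.1 k.2.1 w k.2.2) ''
      (Set.Icc (-1 : ℝ) 0 ×ˢ Metric.closedBall (0 : ℝ) 1 ×ˢ {φ : PortField R | portNormSq R φ = 1}) := by
  ext r
  simp only [Set.mem_setOf_eq, Set.mem_image, Set.mem_prod, Set.mem_Icc, Metric.mem_closedBall, Real.dist_eq,
    sub_zero, Prod.exists]
  constructor
  · rintro ⟨m₀, lam, φ, h1, h2, h3, h4, rfl⟩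
    exact ⟨m₀, lam, φ, ⟨⟨h1, h2⟩, h3, h4⟩, rfl⟩
  · rintro ⟨m₀, lam, φ, ⟨⟨h1, h2⟩, h3, h4⟩, rfl⟩
    exact ⟨m₀, lam, φ, h1, h2, h3, h4, rfl⟩

/-- **The infimum is attained** (`R ≥ 1`): `badPort R w` is the value of the objective at some feasible
`(m₀, λ, φ)`. -/
theorem exists_badPort_eq {R : ℕ} (hR : 1 ≤ R) (w : LinkData) :
    ∃ (m₀ lam : ℝ) (φ : PortField R), -1 ≤ m₀ ∧ m₀ ≤ 0 ∧ |lam| ≤ 1 ∧ portNormSq R φ = 1 ∧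
      badPort R w = portCurrentSum R w φ + portInteriorResSq R m₀ lam w φ + portFaceResSq R m₀ lam w φ := by
  have hK : IsCompact (Set.Icc (-1 : ℝ) 0 ×ˢ Metric.closedBall (0 : ℝ) 1 ×ˢ {φ : PortField R | portNormSq R φ = 1}) :=
    isCompact_Icc.prod ((isCompact_closedBall _ _).prod (by simpa [portNormSq] using
      (isCompact_sphere_sum_norm_sq (ι := ↥(portDomain R) × Fin 3 × Fin 4) 1)))
  have hne : (Set.Icc (-1 : ℝ) 0 ×ˢ Metric.closedBall (0 : ℝ) 1 ×ˢ {φ : PortField R | portNormSq R φ = 1}).Nonempty := by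
    obtain ⟨φ, hφ⟩ := exists_portNormSq_eq_one hR
    exact ⟨(0, 0, φ), ⟨by norm_num, by norm_num⟩, by simp, hφ⟩
  have hcont : Continuous fun k : ℝ × ℝ × PortField R =>
      portCurrentSum R w k.2.2 + portInteriorResSq R k.1 k.2.1 w k.2.2 + portFaceResSq R k.1 k.2.1 w k.2.2 := by
    have h := portContinuous_objective R
    have h2 := h.comp (Continuous.prodMk continuous_const continuous_id :
      Continuous fun k : ℝ × ℝ × PortField R => ((w, k) : LinkData × ℝ × ℝ × PortField R))
    exact h2
  have hmem := (hK.image hcont).sInf_mem (hne.image _)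
  have hbad : badPort R w = sInf ((fun k : ℝ × ℝ × PortField R =>
        portCurrentSum R w k.2.2 + portInteriorResSq R k.1 k.2.1 w k.2.2 + portFaceResSq R k.1 k.2.1 w k.2.2) ''
      (Set.Icc (-1 : ℝ) 0 ×ˢ Metric.closedBall (0 : ℝ) 1 ×ˢ {φ : PortField R | portNormSq R φ = 1})) := by
    rw [badPort, badPort_set_eq_image]
  rw [← hbad] at hmem
  obtain ⟨⟨m₀, lam, φ⟩, ⟨⟨h1, h2⟩, h3, h4⟩, h5⟩ := hmem
  refine ⟨m₀, lam, φ, h1, h2, ?_, h4, h5.symm⟩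
  simpa [Real.dist_eq] using h3

/-- **The zero set of the port min-functional** (`R ≥ 1`): `badPort R w = 0` iff `w` admits a unit port field with
all cube currents zero and both residuals zero for some `m₀ ∈ [−1,0]`, `|λ| ≤ 1` — a non-zero port-admissible
currentless field.  This is the bad variety of `stub_portSmallBall`. -/
theorem badPort_eq_zero_iff {R : ℕ} (hR : 1 ≤ R) (w : LinkData) :
    badPort R w = 0 ↔ ∃ (m₀ lam : ℝ) (φ : PortField R), -1 ≤ m₀ ∧ m₀ ≤ 0 ∧ |lam| ≤ 1 ∧ portNormSq R φ = 1 ∧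
      portCurrentSum R w φ = 0 ∧ portInteriorResSq R m₀ lam w φ = 0 ∧ portFaceResSq R m₀ lam w φ = 0 := by
  constructor
  · intro h0
    obtain ⟨m₀, lam, φ, h1, h2, h3, h4, h5⟩ := exists_badPort_eq hR w
    rw [h0] at h5
    have ha := portCurrentSum_nonneg R w φ
    have hb := portInteriorResSq_nonneg R m₀ lam w φ
    have hc := portFaceResSq_nonneg R m₀ lam w φ
    exact ⟨m₀, lam, φ, h1, h2, h3, h4, by linarith, by linarith, by linarith⟩
  · rintro ⟨m₀, lam, φ, h1, h2, h3, h4, ha, hb, hc⟩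
    refine le_antisymm ?_ (badPort_nonneg R w)
    refine csInf_le ?_ ⟨m₀, lam, φ, h1, h2, h3, h4, by rw [ha, hb, hc]; ring⟩
    refine ⟨0, ?_⟩
    rintro r ⟨m₀', lam', φ', -, -, -, -, rfl⟩
    exact add_nonneg (add_nonneg (portCurrentSum_nonneg R w φ') (portInteriorResSq_nonneg R m₀' lam' w φ'))
      (portFaceResSq_nonneg R m₀' lam' w φ')

end Summit.QuantumFields.QCD.Cruxes.WegnerEstimate.ResolventCell

end
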